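import Mathlib
import Summits.Ventures.PercRepro2.LocRows
import Summits.Ventures.PercRepro2.SwRow
import Summits.Ventures.PercRepro2.SwOut
import Summits.Ventures.PercRepro2.SwAllRow
import Summits.Ventures.PercRepro2.SwOutAll
import Summits.Ventures.PercRepro2.SwOutArmFlip
import Summits.Ventures.PercRepro2.SwOutArmThm
import Summits.Ventures.PercRepro2.SwOutCoreDefs
import Summits.Ventures.PercRepro2.SwOutCoreHull
import Summits.Ventures.PercRepro2.SwOutCoreDual
import Summits.Ventures.PercRepro2.SwOutCoreKey
import Summits.Ventures.PercRepro2.SwOutEdgeDefs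
import Summits.Ventures.PercRepro2.SwOutEdgeHull
import Summits.Ventures.PercRepro2.SwOutEdgeDual
import Summits.Ventures.PercRepro2.SwOutJunctionH1Defs
import Summits.Ventures.PercRepro2.SwOutEdgeBase

/-!
# The e-core cube: the key is constant along the cube (blind cell PercRepro2, night-4 g16,
2026-08-26; proofs/NIGHT4-G15.md §4, proofs/NIGHT4-G16.md §2)

Along the e-core cube of an e-core base `ζ` (the junction `u` adjacent to `h`): the red cluster
of `u` (`cluster_coreRealE_u`: the red cluster of `h` when `u` is red, else `u` with the red pure
arms), `u` lies in the hull of `h` at every cube point (`u_mem_hull_coreRealE`: through the h–u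
edge itself), the hull of `u` stays in `H` (`hull_u_coreRealE_subset`), the extended hull is `H`
(`extHull_coreRealE`), its blue part is the union of the arms assigned `false`
(`blueExt_coreRealE`), and the canonical e-core base recovers the base from every cube point
(**`coreBaseOfE_coreRealE`**): the key of the core kind — the canonical base with its concrete
arms — is constant on the cube.
-/

namespace Summit.Ventures.PercRepro2

namespace LocRows

open Hull

variable {V : Type*} {E : Type*}

open scoped Classical

variable {ends : E → Sym2 V}

section Key

variable {ι : Type*} {A : ι → Set V} {pure : ι → Prop} {ζ : Config E} {h u : V} {H : Set V}
  (hb : CoreBaseE ends ζ h u H A pure)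
include hb

/-- The red pure arms with `u`. -/
lemma CoreBaseE.mem_cluster_u_of_pure {ω : Config (Option ι)} {i : ι} (hi : ω (some i) = true)
    (hpi : pure i) {x : V} (hx : x ∈ A i) : x ∈ cluster ends (coreRealE ends A h u ζ ω) u :=
  cluster_mono (hb.insideConfig_le_coreRealE hi (Or.inr rfl)) u (hb.pure_conn i hpi x hx)

/-- **The red cluster of `u`**: the red cluster of `h` when `u` is red, else `u` with the red
pure arms. -/
theorem CoreBaseE.cluster_coreRealE_u (ω : Config (Option ι)) :
    cluster ends (coreRealE ends A h u ζ ω) u =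
      if uRedE ends A u pure ω then redSetE ends A h u pure ω
      else {u} ∪ {x | ∃ i, ω (some i) = true ∧ pure i ∧ x ∈ A i} := by
  by_cases hu : uRedE ends A u pure ω
  · rw [if_pos hu, ← hb.cluster_coreRealE]
    have huT := hb.u_mem_cluster_of_uRedE hu
    ext x
    exact ⟨fun hx => conn_trans huT hx, fun hx => conn_trans (conn_symm huT) hx⟩
  · rw [if_neg hu]
    apply Set.Subset.antisymm
    · intro v hv
      refine mem_of_conn_of_closed (ends := ends) (ω := coreRealE ends A h u ζ ω)
        (S := {u} ∪ {x | ∃ i, ω (some i) = true ∧ pure i ∧ x ∈ A i}) ?_ (Or.inl rfl) hv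
      intro a ha b hab
      obtain ⟨_, e, he, hends⟩ := openGraph_adj.1 hab
      rcases ha with ha | ⟨i, hi, hpi, ha⟩
      · rw [Set.mem_singleton_iff] at ha
        subst ha
        rcases hb.red_of_red_at_u hends he with ⟨_, hn⟩ | ⟨j, hj, hbj⟩
        · exact absurd (Or.inl hn) hu
        · by_cases hpj : pure j
          · exact Or.inr ⟨j, hj, hpj, hbj⟩
          · exact absurd (Or.inr ⟨j, hj, hpj, e, b, hends, hbj⟩) hu
      · rcases hb.end_of_red_of_mem_arm hi hends ha he with hbi | hbh | hbu
        · exact Or.inr ⟨i, hi, hpi, hbi⟩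
        · exfalso
          subst hbh
          exact hb.pure_no_h i hpi e a (ends_swap hends) ha
        · exact Or.inl hbu
    · rintro v (hv | ⟨i, hi, hpi, hv⟩)
      · rw [Set.mem_singleton_iff] at hv; subst hv; exact mem_cluster_self _ _ _
      · exact hb.mem_cluster_u_of_pure hi hpi hv

/-- The blue cluster of `u` along the cube. -/
theorem CoreBaseE.cluster_blue_coreRealE_u (ω : Config (Option ι)) :
    cluster ends (blue (coreRealE ends A h u ζ ω)) u =
      if uRedE ends A u pure (flipAll ω) then redSetE ends A h u pure (flipAll ω)
      else {u} ∪ {x | ∃ i, flipAll ω (some i) = true ∧ pure i ∧ x ∈ A i} := by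
  rw [hb.blue_coreRealE]
  exact hb.dual.cluster_coreRealE_u (flipAll ω)

/-- `u` lies in the hull of `h` at every cube point (through the h–u edge). -/
theorem CoreBaseE.u_mem_hull_coreRealE (ω : Config (Option ι)) :
    u ∈ hull ends (coreRealE ends A h u ζ ω) h := by
  by_cases hn : ω none = true
  · exact Or.inl (hb.u_mem_cluster_of_uRedE (Or.inl hn))
  · right
    rw [hb.cluster_blue_coreRealE]
    have hn' : flipAll ω none = true := by simp only [flipAll]; simpa using hn
    exact (hb.dual.cluster_coreRealE (flipAll ω)) ▸ hb.dual.u_mem_cluster_of_uRedE (Or.inl hn')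

/-- The hull of `u` lies in `H` at every cube point. -/
theorem CoreBaseE.hull_u_coreRealE_subset (ω : Config (Option ι)) :
    hull ends (coreRealE ends A h u ζ ω) u ⊆ H := by
  have key : ∀ (ω' : Config (Option ι)),
      (if uRedE ends A u pure ω' then redSetE ends A h u pure ω'
        else {u} ∪ {x | ∃ i, ω' (some i) = true ∧ pure i ∧ x ∈ A i}) ⊆ H := by
    intro ω' x hx
    split_ifs at hx with hu
    · exact hb.redSetE_subset ω' hx
    · rcases hx with hx | ⟨i, _, _, hx⟩
      · rw [Set.mem_singleton_iff] at hx; subst hx; exact hb.u_mem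
      · exact (hb.arm_sub i x hx).1
  intro x hx
  rcases hx with hx | hx
  · rw [hb.cluster_coreRealE_u] at hx; exact key ω hx
  · rw [hb.cluster_blue_coreRealE_u] at hx; exact key (flipAll ω) hx

/-- **The extended hull is `H` at every cube point.** -/
theorem CoreBaseE.extHull_coreRealE (ω : Config (Option ι)) :
    extHull ends (coreRealE ends A h u ζ ω) h u = H := by
  apply Set.Subset.antisymm
  · intro x hx
    rcases hx with hx | hx
    · exact hb.hull_coreRealE_subset ω hx
    · exact hb.hull_u_coreRealE_subset ω hx
  · intro x hxH
    by_cases hxh : x = h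
    · subst hxh; exact Or.inl (Or.inl (mem_cluster_self _ _ _))
    by_cases hxu : x = u
    · subst hxu; exact Or.inl (hb.u_mem_hull_coreRealE ω)
    obtain ⟨i, hxi⟩ := hb.arm_cover x hxH hxh hxu
    by_cases hi : ω (some i) = true
    · by_cases hpi : pure i
      · exact Or.inr (Or.inl (hb.mem_cluster_u_of_pure hi hpi hxi))
      · exact Or.inl (Or.inl (hb.mem_cluster_of_harm hi hpi hxi))
    · have hi' : flipAll ω (some i) = true := by simp only [flipAll]; simpa using hi
      by_cases hpi : pure i
      · right; right
        rw [hb.blue_coreRealE]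
        exact hb.dual.mem_cluster_u_of_pure hi' hpi hxi
      · left; right
        rw [hb.blue_coreRealE]
        exact hb.dual.mem_cluster_of_harm hi' hpi hxi

/-- **The blue part of the extended hull is the set of arms assigned `false`.** -/
theorem CoreBaseE.blueExt_coreRealE (ω : Config (Option ι)) :
    blueExt ends (coreRealE ends A h u ζ ω) h u = armsFalseC A (ω ∘ some) := by
  ext x
  simp only [blueExt, Set.mem_sdiff, Set.mem_union, Set.mem_insert_iff, Set.mem_singleton_iff,
    not_or]
  rw [hb.cluster_blue_coreRealE, hb.cluster_blue_coreRealE_u]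
  constructor
  · rintro ⟨hx, hxh, hxu⟩
    have key : ∀ (ω' : Config (Option ι)), x ∈ redSetE ends A h u pure ω' →
        ∃ i, ω' (some i) = true ∧ x ∈ A i := by
      intro ω' hx'
      rw [mem_redSetE_iff] at hx'
      rcases hx' with rfl | ⟨i, hi, _, hx'⟩ | ⟨_, rfl | ⟨i, hi, _, hx'⟩⟩
      · exact absurd rfl hxh
      · exact ⟨i, hi, hx'⟩
      · exact absurd rfl hxu
      · exact ⟨i, hi, hx'⟩
    have key2 : ∃ i, flipAll ω (some i) = true ∧ x ∈ A i := by
      rcases hx with hx | hx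
      · exact key _ hx
      · split_ifs at hx with hu
        · exact key _ hx
        · rcases hx with hx | ⟨i, hi, _, hx⟩
          · exact absurd hx hxu
          · exact ⟨i, hi, hx⟩
    obtain ⟨i, hi, hxi⟩ := key2
    refine ⟨i, ?_, hxi⟩
    simp only [flipAll] at hi
    simpa using hi
  · rintro ⟨i, hi, hxi⟩
    have hi' : flipAll ω (some i) = true := by
      simp only [flipAll]
      have : ω (some i) = false := hi
      rw [this]; rfl
    refine ⟨?_, (hb.arm_sub i x hxi).2.1, (hb.arm_sub i x hxi).2.2⟩
    by_cases hpi : pure i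
    · right
      split_ifs with hu
      · rw [mem_redSetE_iff]; exact Or.inr (Or.inr ⟨hu, Or.inr ⟨i, hi', hpi, hxi⟩⟩)
      · exact Or.inr ⟨i, hi', hpi, hxi⟩
    · left
      rw [mem_redSetE_iff]; exact Or.inr (Or.inl ⟨i, hi', hpi, hxi⟩)

/-- **The canonical e-core base recovers the base from every cube point.** -/
theorem CoreBaseE.coreBaseOfE_coreRealE (ω : Config (Option ι)) :
    coreBaseOfE ends (coreRealE ends A h u ζ ω) h u = ζ := by
  funext e
  by_cases hhu : ends e = s(h, u)
  · rw [coreBaseOfE_apply_hu hhu, hb.hu_red hhu]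
  · rw [coreBaseOfE_apply_of_not_hu hhu]
    unfold coreBaseOf
    rw [hb.blueExt_coreRealE]
    simp only [Hull.flip, coreRealE, if_neg hhu, coreReal]
    split_ifs <;> simp

end Key

end LocRows

end Summit.Ventures.PercRepro2
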